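import Literature.Analysis.OperatorTheory.PseudoResolventCompactPerturbation
import HarnessLib

/-!
# Relatively compact UNBOUNDED perturbations `𝒯 : D(T) → H` through pseudo-resolvents
  (Albritton–Brué–Colombo 2022, §2.1, the form "`𝒯 R(λ, 𝓛)` is compact")

Analysis/OperatorTheory proofs-layer file (theorems only, no definitions, no named facts),
generalising `PseudoResolventCompactPerturbation.lean` from bounded `K` to perturbations defined
only on the domain: `T = operatorOfResolvent J z₀` is the closed operator of an injective
pseudo-resolvent `J` on an open connected `D` (`J(z) = (z − T)⁻¹`), and the perturbation is a
linear map `Kop : D(T) →ₗ H` (e.g. the first-order operator `U ↦ −ℙ(Ū·∇U + U·∇Ū)` of [ABC]),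
about which we only assume that the composites `𝒯J(z)` are given bounded operators
`KJ z : H →L H` (`KJ z v = Kop (J z v)`, relative boundedness) which are compact (relative
compactness: "`𝒯` is compact from `D(𝓛)` with the graph norm to `H`" ⟺ "`𝒯R(λ,𝓛)` compact").

* `kj_sub`: the **first resolvent identity for `𝒯J`**: `KJ z − KJ w = (w − z) KJ z ∘ J w`; hence
  `differentiableOn_kj`: `z ↦ KJ z` is holomorphic on `D` — no analyticity hypothesis needed;
* `eigenvector_of_kj_apply_eq` / `not_isUnit_of_eigenvector'`: `KJ z ψ = ψ ≠ 0` iff-type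
  correspondence with eigenvectors `u ∈ D(T)`, `T u + 𝒯 u = z u`;
* `rel_compact_perturbation_dichotomy`, `rel_compact_perturbation_isolated_eigenvalues`: the
  analytic Fredholm alternative for `T + 𝒯` on `D` ([ABC] §2.1 (i)/(ii)): one good point
  `z₁ ∈ D` with `1 − 𝒯J(z₁)` invertible ⟹ invertibility off a discrete set, and every
  exceptional point is an eigenvalue of `T + 𝒯` with an eigenvector in `D(T)`.

## References

* D. Albritton, E. Brué, M. Colombo, Ann. of Math. 196 (2022), arXiv:2112.03116, §2.1
  ("An operator `𝒯 : D(𝓛) ⊂ H → H` is relatively compact with respect to `𝓛` if …"; spectral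
  consequences (i)/(ii)). [AlbrittonBrueColombo2022AnnMath]
* T. Kato, *Perturbation Theory for Linear Operators* (1966), IV-§1.1 (relative boundedness),
  IV-§5.6 Thm. 5.35, VIII-§1.1. [Kato1966]
* M. Reed, B. Simon, *Methods of Modern Mathematical Physics I*, Thm. VI.14. [ReedSimonI1980]
-/

noncomputable section

open Set Filter Topology

namespace Literature.Analysis.OperatorTheory

namespace IsPseudoResolvent

section RelBounded

variable {E : Type*} [NormedAddCommGroup E] [NormedSpace ℂ E]
variable {D : Set ℂ} {J : ℂ → E →L[ℂ] E} {z₀ : ℂ} {hinj : Function.Injective (J z₀)}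

/-- **First resolvent identity for `𝒯J`**: if `KJ z v = Kop (J z v)` on `D` for a linear
`Kop : D(T) → E`, then `KJ z − KJ w = (w − z) KJ z ∘ J w` (`z, w ∈ D`).
[cite: AlbrittonBrueColombo2022AnnMath, §2.1] -/
theorem kj_sub (h : IsPseudoResolvent D J) (hz₀ : z₀ ∈ D)
    (Kop : (operatorOfResolvent J z₀ hinj).domain →ₗ[ℂ] E) {KJ : ℂ → E →L[ℂ] E}
    (hKJ : ∀ z (hz : z ∈ D) (v : E), KJ z v = Kop ⟨J z v, h.apply_mem_domain_of_mem hz₀ hz v⟩)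
    {z w : ℂ} (hz : z ∈ D) (hw : w ∈ D) :
    KJ z - KJ w = (w - z) • (KJ z).comp (J w) := by
  ext v
  rw [sub_apply, smul_apply,
    ContinuousLinearMap.comp_apply, hKJ z hz, hKJ w hw, hKJ z hz, ← map_sub, ← map_smul]
  congr 1
  apply Subtype.ext
  simp only [SetLike.mk_smul_mk, AddSubgroupClass.coe_sub]
  have := congrArg (fun S : E →L[ℂ] E => S v) (h hz hw)
  simpa only [sub_apply, smul_apply,
    mul_apply_eq_comp] using this

/-- **`z ↦ 𝒯J(z)` is holomorphic on `D`** (from `kj_sub` and holomorphy of `J`; no extra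
hypothesis). [cite: AlbrittonBrueColombo2022AnnMath, §2.1] -/
theorem differentiableOn_kj [CompleteSpace E] (h : IsPseudoResolvent D J) (hD : IsOpen D) (hz₀ : z₀ ∈ D)
    (Kop : (operatorOfResolvent J z₀ hinj).domain →ₗ[ℂ] E) {KJ : ℂ → E →L[ℂ] E}
    (hKJ : ∀ z (hz : z ∈ D) (v : E), KJ z v = Kop ⟨J z v, h.apply_mem_domain_of_mem hz₀ hz v⟩) :
    DifferentiableOn ℂ KJ D := by
  intro z hz
  -- near `z`: `KJ w = KJ z − (w − z) • KJ z ∘ J w`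
  have heq : ∀ w ∈ D, KJ w = KJ z - (w - z) • (KJ z).comp (J w) := by
    intro w hw
    rw [← kj_sub h hz₀ Kop hKJ hz hw]
    abel
  have hdiff : DifferentiableOn ℂ (fun w => KJ z - (w - z) • (KJ z).comp (J w)) D :=
    (differentiableOn_const _).sub
      (((differentiableOn_id).sub (differentiableOn_const _)).smul
        (((ContinuousLinearMap.compL ℂ E E E) (KJ z)).differentiable.comp_differentiableOn
          (h.differentiableOn hD)))
  exact (hdiff z hz).congr (fun w hw => heq w hw) (heq z hz)

/-- **A fixed vector of `𝒯J(z)` gives an eigenvector of `T + 𝒯`**: `KJ z ψ = ψ ⟹` with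
`u = J(z)ψ ∈ D(T)`, `T u + 𝒯 u = z u`. [cite: AlbrittonBrueColombo2022AnnMath, §2.1] -/
theorem eigenvector_of_kj_apply_eq (h : IsPseudoResolvent D J) (hz₀ : z₀ ∈ D)
    (Kop : (operatorOfResolvent J z₀ hinj).domain →ₗ[ℂ] E) {KJ : ℂ → E →L[ℂ] E}
    (hKJ : ∀ z (hz : z ∈ D) (v : E), KJ z v = Kop ⟨J z v, h.apply_mem_domain_of_mem hz₀ hz v⟩)
    {z : ℂ} (hz : z ∈ D) {ψ : E} (hψ : KJ z ψ = ψ) :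
    operatorOfResolvent J z₀ hinj ⟨J z ψ, h.apply_mem_domain_of_mem hz₀ hz ψ⟩ +
        Kop ⟨J z ψ, h.apply_mem_domain_of_mem hz₀ hz ψ⟩ = z • J z ψ := by
  rw [← hKJ z hz, hψ, h.apply_resolvent_of_mem hz₀ hz ψ]
  abel

/-- … and `J z ψ ≠ 0` when `ψ ≠ 0`. [folklore] -/
theorem apply_ne_zero_of_kj_apply_eq (h : IsPseudoResolvent D J) (hz₀ : z₀ ∈ D)
    (Kop : (operatorOfResolvent J z₀ hinj).domain →ₗ[ℂ] E) {KJ : ℂ → E →L[ℂ] E}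
    (hKJ : ∀ z (hz : z ∈ D) (v : E), KJ z v = Kop ⟨J z v, h.apply_mem_domain_of_mem hz₀ hz v⟩)
    {z : ℂ} (hz : z ∈ D) {ψ : E} (hψ : KJ z ψ = ψ) (hψ0 : ψ ≠ 0) : J z ψ ≠ 0 := by
  intro h0
  apply hψ0
  rw [← hψ, hKJ z hz]
  have : (⟨J z ψ, h.apply_mem_domain_of_mem hz₀ hz ψ⟩ : (operatorOfResolvent J z₀ hinj).domain) =
      0 := Subtype.ext h0
  rw [this, map_zero]

/-- **An eigenvector of `T + 𝒯` in `D(T)` with eigenvalue `z ∈ D` makes `1 − 𝒯J(z)`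
non-invertible.** [cite: AlbrittonBrueColombo2022AnnMath, §2.1] -/
theorem not_isUnit_of_eigenvector' [CompleteSpace E] (h : IsPseudoResolvent D J) (hz₀ : z₀ ∈ D)
    (Kop : (operatorOfResolvent J z₀ hinj).domain →ₗ[ℂ] E) {KJ : ℂ → E →L[ℂ] E}
    (hKJ : ∀ z (hz : z ∈ D) (v : E), KJ z v = Kop ⟨J z v, h.apply_mem_domain_of_mem hz₀ hz v⟩)
    {z : ℂ} (hz : z ∈ D) {u : E} (hu : u ∈ (operatorOfResolvent J z₀ hinj).domain) (hu0 : u ≠ 0)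
    (heig : operatorOfResolvent J z₀ hinj ⟨u, hu⟩ + Kop ⟨u, hu⟩ = z • u) :
    ¬ IsUnit (1 - KJ z) := by
  intro hunit
  set w : E := z • u - operatorOfResolvent J z₀ hinj ⟨u, hu⟩ with hw
  have hJw : J z w = u := h.resolvent_apply_sub hz₀ hz hu
  have hwK : w = Kop ⟨u, hu⟩ := by
    rw [hw, ← heig]; abel
  have hker : (1 - KJ z) w = 0 := by
    rw [sub_apply, one_apply_eq_self, hKJ z hz]
    have : (⟨J z w, h.apply_mem_domain_of_mem hz₀ hz w⟩ : (operatorOfResolvent J z₀ hinj).domain) =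
        ⟨u, hu⟩ := Subtype.ext hJw
    rw [this, ← hwK, sub_self]
  have hinjU : Function.Injective ((1 - KJ z : E →L[ℂ] E) : E → E) :=
    (ContinuousLinearMap.isUnit_iff_bijective.1 hunit).1
  have hw0 : w = 0 := hinjU (by rw [hker, map_zero])
  apply hu0
  rw [← hJw, hw0, map_zero]

/-- **The inverse of `z − (T + 𝒯)` when `1 − 𝒯J(z)` is invertible**: with
`R = J(z)(1 − 𝒯J(z))⁻¹`, `z R v − (T (R v) + 𝒯 (R v)) = v`. [cite: AlbrittonBrueColombo2022AnnMath, §2.1] -/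
theorem sub_apply_inverse_of_isUnit' (h : IsPseudoResolvent D J) (hz₀ : z₀ ∈ D)
    (Kop : (operatorOfResolvent J z₀ hinj).domain →ₗ[ℂ] E) {KJ : ℂ → E →L[ℂ] E}
    (hKJ : ∀ z (hz : z ∈ D) (v : E), KJ z v = Kop ⟨J z v, h.apply_mem_domain_of_mem hz₀ hz v⟩)
    {z : ℂ} (hz : z ∈ D) (hunit : IsUnit (1 - KJ z)) (v : E) :
    z • J z (Ring.inverse (1 - KJ z) v) -
        (operatorOfResolvent J z₀ hinj ⟨J z (Ring.inverse (1 - KJ z) v),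
            h.apply_mem_domain_of_mem hz₀ hz _⟩ + Kop ⟨J z (Ring.inverse (1 - KJ z) v),
            h.apply_mem_domain_of_mem hz₀ hz _⟩) = v := by
  set w : E := Ring.inverse (1 - KJ z) v with hw
  rw [h.apply_resolvent_of_mem hz₀ hz w, ← hKJ z hz]
  have hVw : (1 - KJ z) w = v := by
    have h1 : (1 - KJ z) * Ring.inverse (1 - KJ z) = 1 := Ring.mul_inverse_cancel _ hunit
    have h2 := congrArg (fun S : E →L[ℂ] E => S v) h1
    simpa only [mul_apply_eq_comp, one_apply_eq_self] using h2
  rw [sub_apply, one_apply_eq_self] at hVw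
  rw [← hVw]
  abel

/-- … and `R (z u − (T u + 𝒯 u)) = u` for `u ∈ D(T)`. [cite: AlbrittonBrueColombo2022AnnMath, §2.1] -/
theorem inverse_apply_sub_of_isUnit' (h : IsPseudoResolvent D J) (hz₀ : z₀ ∈ D)
    (Kop : (operatorOfResolvent J z₀ hinj).domain →ₗ[ℂ] E) {KJ : ℂ → E →L[ℂ] E}
    (hKJ : ∀ z (hz : z ∈ D) (v : E), KJ z v = Kop ⟨J z v, h.apply_mem_domain_of_mem hz₀ hz v⟩)
    {z : ℂ} (hz : z ∈ D) (hunit : IsUnit (1 - KJ z)) {u : E}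
    (hu : u ∈ (operatorOfResolvent J z₀ hinj).domain) :
    J z (Ring.inverse (1 - KJ z)
      (z • u - (operatorOfResolvent J z₀ hinj ⟨u, hu⟩ + Kop ⟨u, hu⟩))) = u := by
  set w : E := z • u - operatorOfResolvent J z₀ hinj ⟨u, hu⟩ with hw
  have hJw : J z w = u := h.resolvent_apply_sub hz₀ hz hu
  have heq : z • u - (operatorOfResolvent J z₀ hinj ⟨u, hu⟩ + Kop ⟨u, hu⟩) = (1 - KJ z) w := by
    rw [sub_apply, one_apply_eq_self, hKJ z hz]
    have : (⟨J z w, h.apply_mem_domain_of_mem hz₀ hz w⟩ : (operatorOfResolvent J z₀ hinj).domain) =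
        ⟨u, hu⟩ := Subtype.ext hJw
    rw [this, hw]
    abel
  rw [heq]
  have h1 : Ring.inverse (1 - KJ z) * (1 - KJ z) = 1 := Ring.inverse_mul_cancel _ hunit
  have h2 := congrArg (fun S : E →L[ℂ] E => S w) h1
  simp only [mul_apply_eq_comp, one_apply_eq_self] at h2
  rw [h2, hJw]

end RelBounded

/-! ### The analytic Fredholm alternative for `T + 𝒯` -/

section Dichotomy

variable {H : Type} [NormedAddCommGroup H] [InnerProductSpace ℂ H] [CompleteSpace H]
variable {D : Set ℂ} {J : ℂ → H →L[ℂ] H} {z₀ : ℂ} {hinj : Function.Injective (J z₀)}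

/-- **Relatively compact unbounded perturbations: the dichotomy** ([ABC] §2.1 (i)/(ii)): with
`𝒯J(z)` compact on the open connected `D`, either `1 − 𝒯J(z)` is invertible for no `z ∈ D`,
or it is invertible on a punctured neighbourhood of every point and each exceptional `z` carries
`ψ ≠ 0` with `𝒯J(z)ψ = ψ`. [cite: AlbrittonBrueColombo2022AnnMath, §2.1 (spectral preliminaries (i)/(ii))] -/
theorem rel_compact_perturbation_dichotomy (h : IsPseudoResolvent D J) (hD : IsOpen D)
    (hDc : IsConnected D) (hz₀ : z₀ ∈ D)
    (Kop : (operatorOfResolvent J z₀ hinj).domain →ₗ[ℂ] H) {KJ : ℂ → H →L[ℂ] H}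
    (hKJ : ∀ z (hz : z ∈ D) (v : H), KJ z v = Kop ⟨J z v, h.apply_mem_domain_of_mem hz₀ hz v⟩)
    (hK : ∀ z ∈ D, IsCompactOperator (KJ z)) :
    (∀ z ∈ D, ¬ IsUnit (1 - KJ z)) ∨
      ((∀ z ∈ D, ∀ᶠ w in 𝓝[≠] z, IsUnit (1 - KJ w)) ∧
        ∀ z ∈ D, ¬ IsUnit (1 - KJ z) → ∃ ψ : H, ψ ≠ 0 ∧ KJ z ψ = ψ) :=
  analytic_fredholm_holds H D KJ hD hDc (h.differentiableOn_kj hD hz₀ Kop hKJ) hK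

/-- **Isolated eigenvalues of `T + 𝒯`** ([ABC] §2.1: "relatively compact perturbations do not
disturb the essential spectrum … we typically know that the perturbed operator `𝓛 + 𝒯` is
invertible for `Re λ ≫ 1`. Hence, the spectrum in `{Re λ > μ}` consists of isolated points"):
one good point `z₁ ∈ D` ⟹ punctured neighbourhoods of invertibility everywhere in `D` (where
`z − (T + 𝒯)` has the two-sided inverse `J(z)(1 − 𝒯J(z))⁻¹`, `sub_apply_inverse_of_isUnit'` /
`inverse_apply_sub_of_isUnit'`), and at each exceptional `z ∈ D` an eigenvector of `T + 𝒯` in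
`D(T)`. [cite: AlbrittonBrueColombo2022AnnMath, §2.1 (spectral preliminaries)] -/
theorem rel_compact_perturbation_isolated_eigenvalues (h : IsPseudoResolvent D J) (hD : IsOpen D)
    (hDc : IsConnected D) (hz₀ : z₀ ∈ D)
    (Kop : (operatorOfResolvent J z₀ hinj).domain →ₗ[ℂ] H) {KJ : ℂ → H →L[ℂ] H}
    (hKJ : ∀ z (hz : z ∈ D) (v : H), KJ z v = Kop ⟨J z v, h.apply_mem_domain_of_mem hz₀ hz v⟩)
    (hK : ∀ z ∈ D, IsCompactOperator (KJ z)) {z₁ : ℂ} (hz₁ : z₁ ∈ D)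
    (hz₁u : IsUnit (1 - KJ z₁)) :
    (∀ z ∈ D, ∀ᶠ w in 𝓝[≠] z, IsUnit (1 - KJ w)) ∧
      ∀ z ∈ D, ¬ IsUnit (1 - KJ z) →
        ∃ u : H, u ≠ 0 ∧ ∃ hu : u ∈ (operatorOfResolvent J z₀ hinj).domain,
          operatorOfResolvent J z₀ hinj ⟨u, hu⟩ + Kop ⟨u, hu⟩ = z • u := by
  rcases h.rel_compact_perturbation_dichotomy hD hDc hz₀ Kop hKJ hK with hbad | ⟨h1, h2⟩
  · exact absurd hz₁u (hbad z₁ hz₁)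
  · refine ⟨h1, fun z hz hnu => ?_⟩
    obtain ⟨ψ, hψ0, hψ⟩ := h2 z hz hnu
    exact ⟨J z ψ, h.apply_ne_zero_of_kj_apply_eq hz₀ Kop hKJ hz hψ hψ0,
      h.apply_mem_domain_of_mem hz₀ hz ψ, h.eigenvector_of_kj_apply_eq hz₀ Kop hKJ hz hψ⟩

end Dichotomy

end IsPseudoResolvent

end Literature.Analysis.OperatorTheory
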